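import Mathlib.Tactic
import HarnessLib
import HarnessLib.Audit.Tags
import Summits.CriticalPhenomena.PercolationContinuityZ3.Theorems.PercNearOneGluingNoHeavyLowerTailSahiAntichainBlowupJoins

/-!
# Antichains, meets plus joins: a `C([4],2)` blow-up side — new meets in the two-whole-blocks regime

Support file (seat `prim-masterthm-p1`, gen 38; `--supports stmt-CriticalPhenomena-4575`).  No `sorry`, no new definitions, standard
axioms.  Memo `run/shared/lean/prim/prim-masterthm/FROM-prim-masterthm-p1-g38-BLOWUP-SIDE.md` §2.  Continues `…BlowupJoins`.

SETTING: `above P r = {K ∪ B i ∪ B j : i ≠ j}` is a blow-up of `C([4],2)` (`r ∈ K`, blocks `B i` non-empty, pairwise disjoint,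
disjoint from `K`).  By `…BlowupJoins`, a member below with few whole blocks gives four new joins by itself; so we may assume the
**regime (R)**: every member `d` below contains a whole block among any three blocks, and two whole blocks among any two if `d`
leaves the ground `K ∪ ⋃ B` (hypothesis `hR`).  Under (R) every member below misses at most one block entirely
(`touches_of_regime`), and an old cross meet `(K ∪ B i ∪ B j) ∩ b = d ∩ d'` is rigid block by block.

NEW HERE ([this work], gen 38), all under (R):
* `inter_mem_newMeets_of_single_partial` (M1): if `b` misses block `v` and does not contain block `u`, the cross meet
  `(K ∪ B u ∪ B v) ∩ b = (K ∩ b) ∪ (B u ∩ b)` is NEW — were it `d ∩ d'`, each of `d, d'` has a whole block among the other three,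
  these are different and each is absent from the other member, the fourth block is met by both but whole in neither, so (R) makes
  `B u` whole in both, i.e. whole in `b`;
* `two_newMeets_of_whole_block_old` (M2): if `b ⊇ B s` misses block `v` and the cross meet `(K ∩ b) ∪ B s` is OLD, `= d ∩ d'`, then
  `d` and `d'` are of the shape of (M1) with disjoint partial parts in a common block, giving two distinct new meets;
* `newMeets_nonempty_of_two_partial` (M3): if `b` contains blocks `s, t` and meets `u, v` partially, some cross meet is new (either
  `(K ∪ B u ∪ B v) ∩ b` itself, or one through a member of an old representation of it, again by (M1)).
HONEST FRAMING: unconditional lemmas about an explicitly parametrised configuration; the blow-up side lemma is completed in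
`…BlowupSide`. [this work]
-/

namespace Summit.CriticalPhenomena.PercolationContinuityZ3.Theorems.SahiColouredDaykin

open Finset

variable {α : Type*} [DecidableEq α]

/-- The three indices of `Fin 4` other than `u`. [this work] -/
theorem fin4_exists_three_others (u : Fin 4) : ∃ s t v : Fin 4, s ≠ t ∧ s ≠ v ∧ t ≠ v ∧ s ≠ u ∧ t ≠ u ∧ v ≠ u := by
  revert u; decide

section Blowup

variable {P : Finset (Finset α)} {r : α} {K : Finset α} {B : Fin 4 → Finset α}

/-! ### 1. The regime (R) -/

/-- Under (R), next to any block `u` some other block is whole in `d`. [this work] -/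
theorem exists_whole_ne_of_regime
    (hR : ∀ d ∈ below P r, (∀ t u v : Fin 4, t ≠ u → t ≠ v → u ≠ v → B t ⊆ d ∨ B u ⊆ d ∨ B v ⊆ d) ∧
      (¬ d ⊆ K ∪ Finset.univ.biUnion B → ∀ u v : Fin 4, u ≠ v → B u ⊆ d ∨ B v ⊆ d))
    {d : Finset α} (hd : d ∈ below P r) (u : Fin 4) : ∃ m, m ≠ u ∧ B m ⊆ d := by
  obtain ⟨s, t, v, hst, hsv, htv, hsu, htu, hvu⟩ := fin4_exists_three_others u
  rcases (hR d hd).1 s t v hst hsv htv with h | h | h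
  · exact ⟨s, hsu, h⟩
  · exact ⟨t, htu, h⟩
  · exact ⟨v, hvu, h⟩

/-- **Under (R) a member below misses at most one block entirely.** [this work] -/
theorem touches_of_regime (hanti : IsAntichain (· ⊆ ·) (P : Set (Finset α)))
    (hA : ∀ a, a ∈ above P r ↔ ∃ i j, i ≠ j ∧ a = K ∪ B i ∪ B j) (hne : ∀ i, (B i).Nonempty) (hr : r ∈ K)
    (hR : ∀ d ∈ below P r, (∀ t u v : Fin 4, t ≠ u → t ≠ v → u ≠ v → B t ⊆ d ∨ B u ⊆ d ∨ B v ⊆ d) ∧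
      (¬ d ⊆ K ∪ Finset.univ.biUnion B → ∀ u v : Fin 4, u ≠ v → B u ⊆ d ∨ B v ⊆ d))
    {d : Finset α} (hd : d ∈ below P r) {u v : Fin 4} (huv : u ≠ v) (hu : B u ∩ d = ∅) : (B v ∩ d).Nonempty := by
  by_cases hdG : d ⊆ K ∪ Finset.univ.biUnion B
  · obtain ⟨s, t, hst, hsu, hsv, htu, htv⟩ := fin4_exists_other_two huv
    exact touches_of_inside hanti hA hr hd hdG hst hsu hsv htu htv huv hu
  · rw [nonempty_iff_ne_empty]
    intro hv
    rcases (hR d hd).2 hdG u v huv with h | h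
    · obtain ⟨x, hx⟩ := hne u
      have : x ∈ B u ∩ d := mem_inter.2 ⟨hx, h hx⟩
      rw [hu] at this; exact notMem_empty _ this
    · obtain ⟨x, hx⟩ := hne v
      have : x ∈ B v ∩ d := mem_inter.2 ⟨hx, h hx⟩
      rw [hv] at this; exact notMem_empty _ this

/-- A whole block is not an empty trace. [this work] -/
theorem inter_ne_empty_of_subset (hne : ∀ i, (B i).Nonempty) {d : Finset α} {m : Fin 4} (h : B m ⊆ d) : B m ∩ d ≠ ∅ := by
  obtain ⟨x, hx⟩ := hne m
  intro he
  have : x ∈ B m ∩ d := mem_inter.2 ⟨hx, h hx⟩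
  rw [he] at this; exact notMem_empty _ this

/-! ### 2. (M1) the single-partial cross meet is new -/

/-- **(M1)** Under (R): if `b` below misses block `v` and does not contain block `u`, then the cross meet
`(K ∪ B u ∪ B v) ∩ b = (K ∩ b) ∪ (B u ∩ b)` is new. [this work] -/
theorem inter_mem_newMeets_of_single_partial (hanti : IsAntichain (· ⊆ ·) (P : Set (Finset α)))
    (hA : ∀ a, a ∈ above P r ↔ ∃ i j, i ≠ j ∧ a = K ∪ B i ∪ B j)
    (hdis : ∀ i j, i ≠ j → Disjoint (B i) (B j)) (hKB : ∀ i, Disjoint K (B i)) (hne : ∀ i, (B i).Nonempty) (hr : r ∈ K)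
    (hR : ∀ d ∈ below P r, (∀ t u v : Fin 4, t ≠ u → t ≠ v → u ≠ v → B t ⊆ d ∨ B u ⊆ d ∨ B v ⊆ d) ∧
      (¬ d ⊆ K ∪ Finset.univ.biUnion B → ∀ u v : Fin 4, u ≠ v → B u ⊆ d ∨ B v ⊆ d))
    {b : Finset α} (hb : b ∈ below P r) {u v : Fin 4} (huv : u ≠ v) (hv : B v ∩ b = ∅) (hu : ¬ B u ⊆ b) :
    (K ∪ B u ∪ B v) ∩ b ∈ newMeets P r := by
  rw [inter_mem_newMeets_iff (blowup_mem_above hA huv) hb]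
  intro hold
  obtain ⟨d, hd, d', hd', hdd', heq⟩ := mem_meets_iff.1 hold
  -- (E): no block other than `u` has a point in both `d` and `d'`
  have E : ∀ {m : Fin 4}, m ≠ u → ∀ {y : α}, y ∈ B m → y ∈ d → y ∈ d' → False := by
    intro m hmu y hy hyd hyd'
    have hy2 : y ∈ (K ∪ B u ∪ B v) ∩ b := by rw [heq]; exact mem_inter.2 ⟨hyd, hyd'⟩
    obtain ⟨hyA, hyb⟩ := mem_inter.1 hy2
    rcases (mem_blowup_member_iff hdis hKB hy).1 hyA with rfl | rfl
    · exact hmu rfl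
    · have : y ∈ B m ∩ b := mem_inter.2 ⟨hy, hyb⟩
      rw [hv] at this; exact notMem_empty _ this
  -- points of `B u` in both members lie in `b`
  have U : ∀ {y : α}, y ∈ B u → y ∈ d → y ∈ d' → y ∈ b := by
    intro y _ hyd hyd'
    have hy2 : y ∈ (K ∪ B u ∪ B v) ∩ b := by rw [heq]; exact mem_inter.2 ⟨hyd, hyd'⟩
    exact (mem_inter.1 hy2).2
  -- a whole block `m₁ ≠ u` of `d`, absent from `d'`; a whole block `m₂ ≠ u` of `d'`, absent from `d`
  obtain ⟨m₁, hm₁u, hm₁⟩ := exists_whole_ne_of_regime hR hd u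
  obtain ⟨m₂, hm₂u, hm₂⟩ := exists_whole_ne_of_regime hR hd' u
  have e₁ : B m₁ ∩ d' = ∅ := by
    apply eq_empty_of_forall_notMem; intro y hy
    obtain ⟨hy1, hy2⟩ := mem_inter.1 hy
    exact E hm₁u hy1 (hm₁ hy1) hy2
  have e₂ : B m₂ ∩ d = ∅ := by
    apply eq_empty_of_forall_notMem; intro y hy
    obtain ⟨hy1, hy2⟩ := mem_inter.1 hy
    exact E hm₂u hy1 hy2 (hm₂ hy1)
  have h12 : m₁ ≠ m₂ := by
    rintro rfl; exact inter_ne_empty_of_subset hne hm₁ e₂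
  -- the fourth block `m₃` is met by both members but whole in neither
  obtain ⟨m₃, h3u, h31, h32⟩ := fin4_exists_fourth hm₁u.symm hm₂u.symm h12
  have t₃ : (B m₃ ∩ d).Nonempty := touches_of_regime hanti hA hne hr hR hd (Ne.symm h32) e₂
  have t₃' : (B m₃ ∩ d').Nonempty := touches_of_regime hanti hA hne hr hR hd' (Ne.symm h31) e₁
  have n₃ : ¬ B m₃ ⊆ d := by
    intro h
    obtain ⟨y, hy⟩ := t₃'
    obtain ⟨hy1, hy2⟩ := mem_inter.1 hy
    exact E h3u hy1 (h hy1) hy2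
  have n₃' : ¬ B m₃ ⊆ d' := by
    intro h
    obtain ⟨y, hy⟩ := t₃
    obtain ⟨hy1, hy2⟩ := mem_inter.1 hy
    exact E h3u hy1 hy2 (h hy1)
  -- (R) on the blocks `m₂, m₃, u` for `d`, and `m₁, m₃, u` for `d'`: `B u` is whole in both, hence in `b`
  have fu : B u ⊆ d := by
    rcases (hR d hd).1 m₂ m₃ u (Ne.symm h32) hm₂u h3u with h | h | h
    · exact absurd e₂ (inter_ne_empty_of_subset hne h)
    · exact absurd h n₃
    · exact h
  have fu' : B u ⊆ d' := by
    rcases (hR d' hd').1 m₁ m₃ u (Ne.symm h31) hm₁u h3u with h | h | h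
    · exact absurd e₁ (inter_ne_empty_of_subset hne h)
    · exact absurd h n₃'
    · exact h
  exact hu fun y hy => U hy (fu hy) (fu' hy)

/-! ### 3. (M2) an old whole-block cross meet produces two new meets -/

/-- **(M2)** Under (R): if `b` below contains block `s`, misses block `v`, and the cross meet `(K ∪ B s ∪ B v) ∩ b = (K ∩ b) ∪ B s` is
OLD, then there are two distinct new meets. [this work] -/
theorem two_newMeets_of_whole_block_old (hanti : IsAntichain (· ⊆ ·) (P : Set (Finset α)))
    (hA : ∀ a, a ∈ above P r ↔ ∃ i j, i ≠ j ∧ a = K ∪ B i ∪ B j)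
    (hdis : ∀ i j, i ≠ j → Disjoint (B i) (B j)) (hKB : ∀ i, Disjoint K (B i)) (hne : ∀ i, (B i).Nonempty) (hr : r ∈ K)
    (hR : ∀ d ∈ below P r, (∀ t u v : Fin 4, t ≠ u → t ≠ v → u ≠ v → B t ⊆ d ∨ B u ⊆ d ∨ B v ⊆ d) ∧
      (¬ d ⊆ K ∪ Finset.univ.biUnion B → ∀ u v : Fin 4, u ≠ v → B u ⊆ d ∨ B v ⊆ d))
    {b : Finset α} (hb : b ∈ below P r) {s v : Fin 4} (hsv : s ≠ v) (hv : B v ∩ b = ∅)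
    (hold : (K ∪ B s ∪ B v) ∩ b ∉ newMeets P r) :
    ∃ Z₁ ∈ newMeets P r, ∃ Z₂ ∈ newMeets P r, Z₁ ≠ Z₂ := by
  rw [inter_mem_newMeets_iff (blowup_mem_above hA hsv) hb, not_not] at hold
  obtain ⟨d, hd, d', hd', hdd', heq⟩ := mem_meets_iff.1 hold
  have E : ∀ {m : Fin 4}, m ≠ s → ∀ {y : α}, y ∈ B m → y ∈ d → y ∈ d' → False := by
    intro m hms y hy hyd hyd'
    have hy2 : y ∈ (K ∪ B s ∪ B v) ∩ b := by rw [heq]; exact mem_inter.2 ⟨hyd, hyd'⟩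
    obtain ⟨hyA, hyb⟩ := mem_inter.1 hy2
    rcases (mem_blowup_member_iff hdis hKB hy).1 hyA with rfl | rfl
    · exact hms rfl
    · have : y ∈ B m ∩ b := mem_inter.2 ⟨hy, hyb⟩
      rw [hv] at this; exact notMem_empty _ this
  obtain ⟨m₁, hm₁s, hm₁⟩ := exists_whole_ne_of_regime hR hd s
  obtain ⟨m₂, hm₂s, hm₂⟩ := exists_whole_ne_of_regime hR hd' s
  have e₁ : B m₁ ∩ d' = ∅ := by
    apply eq_empty_of_forall_notMem; intro y hy
    obtain ⟨hy1, hy2⟩ := mem_inter.1 hy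
    exact E hm₁s hy1 (hm₁ hy1) hy2
  have e₂ : B m₂ ∩ d = ∅ := by
    apply eq_empty_of_forall_notMem; intro y hy
    obtain ⟨hy1, hy2⟩ := mem_inter.1 hy
    exact E hm₂s hy1 hy2 (hm₂ hy1)
  have h12 : m₁ ≠ m₂ := by
    rintro rfl; exact inter_ne_empty_of_subset hne hm₁ e₂
  obtain ⟨m₃, h3s, h31, h32⟩ := fin4_exists_fourth hm₁s.symm hm₂s.symm h12
  have t₃ : (B m₃ ∩ d).Nonempty := touches_of_regime hanti hA hne hr hR hd (Ne.symm h32) e₂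
  have t₃' : (B m₃ ∩ d').Nonempty := touches_of_regime hanti hA hne hr hR hd' (Ne.symm h31) e₁
  have n₃ : ¬ B m₃ ⊆ d := by
    intro h
    obtain ⟨y, hy⟩ := t₃'
    obtain ⟨hy1, hy2⟩ := mem_inter.1 hy
    exact E h3s hy1 (h hy1) hy2
  have n₃' : ¬ B m₃ ⊆ d' := by
    intro h
    obtain ⟨y, hy⟩ := t₃
    obtain ⟨hy1, hy2⟩ := mem_inter.1 hy
    exact E h3s hy1 hy2 (h hy1)
  -- (M1) for `d` with blocks `(m₃, m₂)` and for `d'` with `(m₃, m₁)`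
  obtain ⟨x, hx⟩ := t₃
  obtain ⟨hx3, hxd⟩ := mem_inter.1 hx
  obtain ⟨x', hx'⟩ := t₃'
  obtain ⟨hx'3, hx'd'⟩ := mem_inter.1 hx'
  have Z₁ := inter_mem_newMeets_of_single_partial hanti hA hdis hKB hne hr hR hd h32 e₂ n₃
  have Z₂ := inter_mem_newMeets_of_single_partial hanti hA hdis hKB hne hr hR hd' h31 e₁ n₃'
  refine ⟨_, Z₁, _, Z₂, fun h => ?_⟩
  have : x ∈ (K ∪ B m₃ ∪ B m₁) ∩ d' := by
    rw [← h]; exact mem_inter.2 ⟨mem_union_left _ (mem_union_right _ hx3), hxd⟩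
  exact E h3s hx3 hxd (mem_inter.1 this).2

/-! ### 4. (M3) two whole and two partial blocks: some cross meet is new -/

/-- (M3), the asymmetric half: in an old representation `(K ∪ B u ∪ B v) ∩ b = d ∩ d'` with `B u` whole in `d`, some cross meet is
new. [this work] -/
theorem newMeets_nonempty_of_two_partial_aux (hanti : IsAntichain (· ⊆ ·) (P : Set (Finset α)))
    (hA : ∀ a, a ∈ above P r ↔ ∃ i j, i ≠ j ∧ a = K ∪ B i ∪ B j)
    (hdis : ∀ i j, i ≠ j → Disjoint (B i) (B j)) (hKB : ∀ i, Disjoint K (B i)) (hne : ∀ i, (B i).Nonempty) (hr : r ∈ K)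
    (hR : ∀ d ∈ below P r, (∀ t u v : Fin 4, t ≠ u → t ≠ v → u ≠ v → B t ⊆ d ∨ B u ⊆ d ∨ B v ⊆ d) ∧
      (¬ d ⊆ K ∪ Finset.univ.biUnion B → ∀ u v : Fin 4, u ≠ v → B u ⊆ d ∨ B v ⊆ d))
    {b : Finset α} {s t u v : Fin 4}
    (hst : s ≠ t) (hsu : s ≠ u) (hsv : s ≠ v) (htu : t ≠ u) (htv : t ≠ v) (huv : u ≠ v)
    (hu : ¬ B u ⊆ b) (hv : ¬ B v ⊆ b) (hu' : (B u ∩ b).Nonempty) (hv' : (B v ∩ b).Nonempty)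
    {d d' : Finset α} (hd : d ∈ below P r) (hd' : d' ∈ below P r) (heq : (K ∪ B u ∪ B v) ∩ b = d ∩ d')
    (hfull : B u ⊆ d) : (newMeets P r).Nonempty := by
  -- block traces of the representation
  have E : ∀ {m : Fin 4}, m ≠ u → m ≠ v → ∀ {y : α}, y ∈ B m → y ∈ d → y ∈ d' → False := by
    intro m hmu hmv y hy hyd hyd'
    have hy2 : y ∈ (K ∪ B u ∪ B v) ∩ b := by rw [heq]; exact mem_inter.2 ⟨hyd, hyd'⟩
    rcases (mem_blowup_member_iff hdis hKB hy).1 (mem_inter.1 hy2).1 with rfl | rfl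
    · exact hmu rfl
    · exact hmv rfl
  have tr : ∀ {m : Fin 4}, m = u ∨ m = v → ∀ {y : α}, y ∈ B m → (y ∈ d ∧ y ∈ d' ↔ y ∈ b) := by
    intro m hm y hy
    constructor
    · intro h
      have hy2 : y ∈ (K ∪ B u ∪ B v) ∩ b := by rw [heq]; exact mem_inter.2 h
      exact (mem_inter.1 hy2).2
    · intro hyb
      have hy2 : y ∈ (K ∪ B u ∪ B v) ∩ b := mem_inter.2 ⟨(mem_blowup_member_iff hdis hKB hy).2 hm, hyb⟩
      rw [heq] at hy2; exact mem_inter.1 hy2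
  -- `u` is partial in `d'`: its trace there is `B u ∩ b`
  have ud' : B u ∩ d' = B u ∩ b := by
    ext y; simp only [mem_inter]
    constructor
    · rintro ⟨hy, hyd'⟩; exact ⟨hy, ((tr (Or.inl rfl) hy).1 ⟨hfull hy, hyd'⟩)⟩
    · rintro ⟨hy, hyb⟩; exact ⟨hy, ((tr (Or.inl rfl) hy).2 hyb).2⟩
  have nud' : ¬ B u ⊆ d' := by
    intro h; apply hu; intro y hy
    have : y ∈ B u ∩ d' := mem_inter.2 ⟨hy, h hy⟩
    rw [ud'] at this; exact (mem_inter.1 this).2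
  -- a whole block `m₁ ∈ {s, t}` of `d'`, absent from `d`
  have hm₁ : ∃ m₁, m₁ ≠ u ∧ m₁ ≠ v ∧ B m₁ ⊆ d' := by
    rcases (hR d' hd').1 s t u hst hsu htu with h | h | h
    · exact ⟨s, hsu, hsv, h⟩
    · exact ⟨t, htu, htv, h⟩
    · exact absurd h nud'
  obtain ⟨m₁, h1u, h1v, hm₁⟩ := hm₁
  have e₁ : B m₁ ∩ d = ∅ := by
    apply eq_empty_of_forall_notMem; intro y hy
    obtain ⟨hy1, hy2⟩ := mem_inter.1 hy
    exact E h1u h1v hy1 hy2 (hm₁ hy1)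
  obtain ⟨m₂, h2m₁, h2u, h2v⟩ := fin4_exists_fourth h1u h1v huv
  -- `d` misses `m₁`, hence meets `m₂` and `v`
  have t₂ : (B m₂ ∩ d).Nonempty := touches_of_regime hanti hA hne hr hR hd h2m₁.symm e₁
  -- (R) for `d` on `m₁, m₂, v`
  rcases (hR d hd).1 m₁ m₂ v h2m₁.symm h1v h2v with h | h | h
  · exact absurd e₁ (inter_ne_empty_of_subset hne h)
  · -- `B m₂` whole in `d`, so absent from `d'`; then (R) for `d'` on `m₂, u, v` makes `B v` whole in `d'`,
    -- and `d` has the shape of (M1): blocks `u, m₂` whole, `m₁` absent, `v` partial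
    have e₂ : B m₂ ∩ d' = ∅ := by
      apply eq_empty_of_forall_notMem; intro y hy
      obtain ⟨hy1, hy2⟩ := mem_inter.1 hy
      exact E h2u h2v hy1 (h hy1) hy2
    have fv' : B v ⊆ d' := by
      rcases (hR d' hd').1 m₂ u v h2u h2v huv with h' | h' | h'
      · exact absurd e₂ (inter_ne_empty_of_subset hne h')
      · exact absurd h' nud'
      · exact h'
    have vd : B v ∩ d = B v ∩ b := by
      ext y; simp only [mem_inter]
      constructor
      · rintro ⟨hy, hyd⟩; exact ⟨hy, (tr (Or.inr rfl) hy).1 ⟨hyd, fv' hy⟩⟩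
      · rintro ⟨hy, hyb⟩; exact ⟨hy, ((tr (Or.inr rfl) hy).2 hyb).1⟩
    have nvd : ¬ B v ⊆ d := by
      intro h'; apply hv; intro y hy
      have : y ∈ B v ∩ d := mem_inter.2 ⟨hy, h' hy⟩
      rw [vd] at this; exact (mem_inter.1 this).2
    obtain ⟨y, hy⟩ := hv'
    obtain ⟨hyv, hyb⟩ := mem_inter.1 hy
    have hyd : y ∈ d := ((tr (Or.inr rfl) hyv).2 hyb).1
    exact ⟨_, inter_mem_newMeets_of_single_partial hanti hA hdis hKB hne hr hR hd h1v.symm e₁ nvd⟩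
  · -- `B v` whole in `d`: then `v` is partial in `d'`, and (R) for `d'` on `m₂, u, v` makes `B m₂` whole in `d'`,
    -- hence absent from `d` — contradicting `t₂`
    have vd' : ∀ {y : α}, y ∈ B v → y ∈ d' → y ∈ b := fun hy hyd' => (tr (Or.inr rfl) hy).1 ⟨h hy, hyd'⟩
    have nvd' : ¬ B v ⊆ d' := by
      intro h'; apply hv; intro y hy; exact vd' hy (h' hy)
    rcases (hR d' hd').1 m₂ u v h2u h2v huv with h' | h' | h'
    · obtain ⟨y, hy⟩ := t₂
      obtain ⟨hy1, hy2⟩ := mem_inter.1 hy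
      exact absurd (E h2u h2v hy1 hy2 (h' hy1)) id
    · exact absurd h' nud'
    · exact absurd h' nvd'

/-- **(M3)** Under (R): if `b` below contains blocks `s, t` and meets blocks `u, v` without containing them, some cross meet is
new. [this work] -/
theorem newMeets_nonempty_of_two_partial (hanti : IsAntichain (· ⊆ ·) (P : Set (Finset α)))
    (hA : ∀ a, a ∈ above P r ↔ ∃ i j, i ≠ j ∧ a = K ∪ B i ∪ B j)
    (hdis : ∀ i j, i ≠ j → Disjoint (B i) (B j)) (hKB : ∀ i, Disjoint K (B i)) (hne : ∀ i, (B i).Nonempty) (hr : r ∈ K)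
    (hR : ∀ d ∈ below P r, (∀ t u v : Fin 4, t ≠ u → t ≠ v → u ≠ v → B t ⊆ d ∨ B u ⊆ d ∨ B v ⊆ d) ∧
      (¬ d ⊆ K ∪ Finset.univ.biUnion B → ∀ u v : Fin 4, u ≠ v → B u ⊆ d ∨ B v ⊆ d))
    {b : Finset α} (hb : b ∈ below P r) {s t u v : Fin 4}
    (hst : s ≠ t) (hsu : s ≠ u) (hsv : s ≠ v) (htu : t ≠ u) (htv : t ≠ v) (huv : u ≠ v)
    (hu : ¬ B u ⊆ b) (hv : ¬ B v ⊆ b) (hu' : (B u ∩ b).Nonempty) (hv' : (B v ∩ b).Nonempty) :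
    (newMeets P r).Nonempty := by
  by_cases hnew : (K ∪ B u ∪ B v) ∩ b ∈ newMeets P r
  · exact ⟨_, hnew⟩
  rw [inter_mem_newMeets_iff (blowup_mem_above hA huv) hb, not_not] at hnew
  obtain ⟨d, hd, d', hd', hdd', heq⟩ := mem_meets_iff.1 hnew
  have E : ∀ {m : Fin 4}, m ≠ u → m ≠ v → ∀ {y : α}, y ∈ B m → y ∈ d → y ∈ d' → False := by
    intro m hmu hmv y hy hyd hyd'
    have hy2 : y ∈ (K ∪ B u ∪ B v) ∩ b := by rw [heq]; exact mem_inter.2 ⟨hyd, hyd'⟩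
    rcases (mem_blowup_member_iff hdis hKB hy).1 (mem_inter.1 hy2).1 with rfl | rfl
    · exact hmu rfl
    · exact hmv rfl
  have trv : ∀ {y : α}, y ∈ B v → y ∈ d → y ∈ d' → y ∈ b := by
    intro y _ hyd hyd'
    have hy2 : y ∈ (K ∪ B u ∪ B v) ∩ b := by rw [heq]; exact mem_inter.2 ⟨hyd, hyd'⟩
    exact (mem_inter.1 hy2).2
  by_cases hfu : B u ⊆ d
  · exact newMeets_nonempty_of_two_partial_aux hanti hA hdis hKB hne hr hR hst hsu hsv htu htv huv hu hv hu' hv' hd hd' heq hfu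
  by_cases hfu' : B u ⊆ d'
  · exact newMeets_nonempty_of_two_partial_aux hanti hA hdis hKB hne hr hR hst hsu hsv htu htv huv hu hv hu' hv' hd' hd
      (heq.trans (inter_comm d d')) hfu'
  · -- neither contains `B u`: whole blocks `m₁` of `d` and `m₂` of `d'` among `s, t`, different; then `B v` whole in `d`,
    -- partial in `d'`, and (R) for `d'` on `m₁, u, v` fails
    exfalso
    have hm₁ : ∃ m₁, m₁ ≠ u ∧ m₁ ≠ v ∧ B m₁ ⊆ d := by
      rcases (hR d hd).1 s t u hst hsu htu with h | h | h
      · exact ⟨s, hsu, hsv, h⟩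
      · exact ⟨t, htu, htv, h⟩
      · exact absurd h hfu
    obtain ⟨m₁, h1u, h1v, hm₁⟩ := hm₁
    have e₁ : B m₁ ∩ d' = ∅ := by
      apply eq_empty_of_forall_notMem; intro y hy
      obtain ⟨hy1, hy2⟩ := mem_inter.1 hy
      exact E h1u h1v hy1 (hm₁ hy1) hy2
    obtain ⟨m₂, h2m₁, h2u, h2v⟩ := fin4_exists_fourth h1u h1v huv
    have hm₂ : B m₂ ⊆ d' := by
      rcases (hR d' hd').1 m₁ m₂ u h2m₁.symm h1u h2u with h | h | h
      · exact absurd e₁ (inter_ne_empty_of_subset hne h)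
      · exact h
      · exact absurd h hfu'
    have e₂ : B m₂ ∩ d = ∅ := by
      apply eq_empty_of_forall_notMem; intro y hy
      obtain ⟨hy1, hy2⟩ := mem_inter.1 hy
      exact E h2u h2v hy1 hy2 (hm₂ hy1)
    have fv : B v ⊆ d := by
      rcases (hR d hd).1 m₂ u v h2u h2v huv with h | h | h
      · exact absurd e₂ (inter_ne_empty_of_subset hne h)
      · exact absurd h hfu
      · exact h
    have nfv' : ¬ B v ⊆ d' := by
      intro h; apply hv; intro y hy; exact trv hy (fv hy) (h hy)
    rcases (hR d' hd').1 m₁ u v h1u h1v huv with h | h | h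
    · exact inter_ne_empty_of_subset hne h e₁
    · exact hfu' h
    · exact nfv' h

end Blowup

end Summit.CriticalPhenomena.PercolationContinuityZ3.Theorems.SahiColouredDaykin
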